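import Literature.MathematicalPhysics.QuantumFieldTheory.Balaban1983to89.B9Eq335CubeDomCoverP

/-!
# `Balaban1983to89.B9Eq335CubeDomCoverWideP` — T. Bałaban, *Propagators for lattice gauge theories in a background field*, Commun. Math. Phys. **99** (1985)
# 389–434 [Balaban1985BackgroundPropagators] p. 409 («□̃⁵ is contained in one of the cubes for which [(3.35)] holds») and p. 408 («Ω_j(□) = □̃⁴», the
# margin of the averaging stencils): the WIDE cover — `□̃(c)` together with a collar of `(L − 4)` big `j(□)`-blocks lies in ONE cube of print's class,
# the aligned cube of `2L` big `j(□)`-blocks, so the `Q(U)`-averaging runs of (3.12) that reach `2L^{j(□)+2} ≤ 2S` out of `□̃` are covered too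

statement-level skeleton of published theorems with citation tags; proofs where landed; nothing here is a claim about the Yang–Mills mass gap

WHY THIS FILE (cell context).  `B9Eq335CubeDomCoverP` (this seat, p636149) covers `□̃(c)` and a collar of ONE big block `S = S_{j(□)}` by the aligned
`10`-cube — enough for the plaquette and `Q′` readings of the local operator `Δ_{a,□}` (node00-def-Y A-3 `OpsYDeltaALocalAgree`, reading radii (P) ≤ 1 step,
(Q′) inside the blocks of `□̃`), but NOT always for the `Q(U)`-transport runs (reading (Q)): a fine bond of `□̃` is averaged by index bonds of level up to
`j(□) + 2` (lit-balaban r05 `B9CubeBondRowAgreementNearH`: `lev_ends_bounds`), whose taxi runs reach `2L^{j(□)+2}` lattice units — up to `2S` when the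
member's `M_h = L` (`KIdx.hMha : M_h = L^a`, `a ≥ 1`).  The collar axiom (2.2) allows aligned class cubes of up to `2L` big blocks (`levV1_window` needs
`n·L ≤ R`, and `R ≥ 2L²`), and `2L ≥ 10`; so this file re-runs the cover with the `2L`-cube cornered `L − 1` big blocks below `β`: its slack around `□̃`
(reach `27S/8`) is `(L − ½)S − 27S/8 ≥ (L − 4)S + S/8`, and `(L − 4)·M_h ≥ 2L` at every index (`L = 5 ⇒ M_h ≥ 25`; `L ≥ 6 ⇒ M_h ≥ L`).

WHAT IS PROVED (sorry-free; 0 `def`; geometry + bookkeeping — nothing of [B9] asserted).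
* §1 ★ `alignedCube_mem_cubeClassP_or` (§1 of the parent for ANY size `10 ≤ n`, `n·L ≤ R`: `(Q, j, n)` or `(Q, j−1, nL)` is a P-triple), `two_L_le_collarBlocks_mul_Mh`
  (`2L ≤ (L − 4)·M_h`, from `M_h = L^a ≥ 8`, `L ≥ 5`), ★ `four_L_le_collarBlocks_mul_Mh` (`4L ≤ (L − 4)·M_h`), `four_pow_le_collar` (`4L^{j+2} ≤ (L − 4)·S_j`), `window_arith_wide`.
* §2 ★★★ **`exists_cubeClassP_cubeDomY_wideCollar`**: `∃ q ∈ cubeClassP x.toKIdx cthr` (`cthr ≤ 10`) of index `j(□)` (size `2L`) or `j(□) − 1` (size `2L²`)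
  containing every torus site within coordinatewise `circAbs ≤ (L − 4)·S_{j(□)}` of a site of `cubeDomY x c`.
* §3 ★★ **`reg335Cube_cubeDomY_wideCollar_of_reg335P`** — the (3.35) datum (ONE gauge, ONE field) on the wide collar at the scale `L^{j(□)}η` with the
  constant `2L⁴·(M·α₀)`; member form `…_of_regYP335` and the `c35Y`-spelled corollary.
HONEST SCOPE.  As the parent: geometry only; NOT a node discharge; count-neutral; nothing continuum ∕ OS ∕ mass gap ∕ Clay.  Cell `pub-ymgap` (HUMAN RULING
D-0062), Track A node N06 [B9], seat `pub-ymgap-dag-n06-j` (harness re-seat gen 23), 2026-08-28.  NEW sibling file importing `B9Eq335CubeDomCoverP` only (the parent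
stays byte-stable at 399 l.); nothing landed is modified.  Net new unproved facts: 0.
-/

namespace Literature.MathematicalPhysics.QuantumFieldTheory.Balaban1983to89.B9Eq335CubeDomCoverWideP

open Literature.MathematicalPhysics.QuantumFieldTheory.Balaban1983to89
open B6KLevelCensusIndexV1 B9BackgroundsKLevelV1 B6GlobalChartV1 Node00 B9BackgroundsKLevelV1P B9Eq335CoverageWindow B9Eq335ClassBridgePV1 B9Eq335CubeDomCoverP
open Literature.MathematicalPhysics.QuantumFieldTheory.Balaban1983to89.B6MultiLevelBoxOperator (bigSide N0)
open Literature.MathematicalPhysics.QuantumFieldTheory.Balaban1983to89.B6Geom246MultiLevelBox (bset blkOf coord_bounds)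
open Literature.MathematicalPhysics.QuantumFieldTheory.Balaban1983to89.B6Cover236MultiLevelBlocks (cubes wit lev_wit blk_wit)
open Literature.MathematicalPhysics.QuantumFieldTheory.Balaban1983to89.B6Cover236MultiLevelTorusBlocks (rep blkOf_rep)
open Literature.MathematicalPhysics.QuantumFieldTheory.Balaban1983to89.B4TorusKernel.MultiPeriod (circAbs abs_add_mul_centre)
open Literature.MathematicalPhysics.QuantumFieldTheory.Balaban1983to89.B4Reflection242 (blk boxDom)
open Literature.MathematicalPhysics.QuantumFieldTheory.Balaban1983to89.B9Eq335RegularityClasses (Reg335Cube)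
open Literature.MathematicalPhysics.QuantumFieldTheory.Balaban1983to89.LatticeNorms (scaleLen)
open Literature.MathematicalPhysics.QuantumFieldTheory.Balaban1983to89.B9PinMembersKLevelV1 (MemberY bg9Y)
open Literature.MathematicalPhysics.QuantumFieldTheory.Balaban1983to89.B9WalkLettersCoordsS (cubeDomY cubeBlksY four_le_P)
open Literature.MathematicalPhysics.QuantumFieldTheory.Balaban1983to89.B9Thm37CubeCoverCommutators (one_le_Mh_and_P)

/-! ## §1 Aligned cubes of `n` big blocks (`10 ≤ n`, `n·L ≤ R`) through a site of their own level are class cubes; the index arithmetic -/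

section Geometry

variable {d ℓ : ℕ} {hd : 1 ≤ d + 1} {hL : Odd (ℓ + 1) ∧ 1 < ℓ + 1} {b₀ b₁ : ℝ}
variable (i : KIdx d ℓ hd hL b₀ b₁)

/-- ★ **ANY ALIGNED CUBE OF `n` BIG `j`-BLOCKS (`10 ≤ n`, `n·L ≤ R`) THROUGH A SITE OF LEVEL `j` IS A CUBE OF PRINT'S CLASS** (threshold `c ≤ 10`): EITHER
`(Q, j, n) ∈ cubeClassP i c` OR `(Q, j−1, nL) ∈ cubeClassP i c` — the parent's `alignedTenCube_mem_cubeClassP_or` with the size freed (the collar axiom (2.2)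
gives the level window on `Q` as long as `n·L ≤ R`). [cite: Balaban1985BackgroundPropagators, p.396 (the cube class, «≧ 10»), p.409; Balaban1984PropagatorsII, (2.2) p.224] -/
theorem alignedCube_mem_cubeClassP_or {c : ℝ} (hc : c ≤ 10) {n : ℕ} (hn10 : 10 ≤ n) (hnR : n * (ℓ + 1) ≤ i.R) {j : ℕ} (hj1 : 1 ≤ j) (hjk : j ≤ i.k)
    (c₀ : Site (PV d ℓ i.m i.K hd hL) 0) (hc₀ : ∀ μ, bigSide ℓ i.Mh j ∣ (c₀ μ).val)
    {x : Site (PV d ℓ i.m i.K hd hL) 0} (hx : x ∈ torusCube c₀ (n * bigSide ℓ i.Mh j)) (hxj : levV1 i x = j) :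
    (torusCube c₀ (n * bigSide ℓ i.Mh j), j, n) ∈ cubeClassP i c ∨
      (torusCube c₀ (n * bigSide ℓ i.Mh j), j - 1, n * (ℓ + 1)) ∈ cubeClassP i c := by
  classical
  set S := bigSide ℓ i.Mh j with hSdef
  have hS : 0 < S := by rw [hSdef]; unfold B6MultiLevelBoxOperator.bigSide; have := i.hM8; positivity
  have hwin : ∀ y ∈ torusCube c₀ (n * S), j ≤ levV1 i y + 1 ∧ levV1 i y ≤ j + 1 := by
    intro y hy
    have hx' : x ∈ torusCube c₀ (n * bigSide ℓ i.Mh (levV1 i x)) := by rw [hxj]; exact hx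
    have hy' : y ∈ torusCube c₀ (n * bigSide ℓ i.Mh (levV1 i x)) := by rw [hxj]; exact hy
    have h := levV1_window i hnR hx' hy'
    rw [hxj] at h
    exact h
  by_cases hlow : ∃ y ∈ torusCube c₀ (n * S), levV1 i y + 1 = j
  · right
    obtain ⟨y, hy, hylev⟩ := hlow
    have hy1 : 1 ≤ levV1 i y := levV1_pos i y
    have hnoup : ∀ z ∈ torusCube c₀ (n * S), levV1 i z ≤ j := by
      intro z hz
      by_contra hzl
      push Not at hzl
      have hyl : i.D.lev (toBox i.hN y).1 = levV1 i y := rfl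
      have hzl' : i.D.lev (toBox i.hN z).1 = levV1 i z := rfl
      have hsep := i.D.sepT j (toBox i.hN y).1 (toBox i.hN y).2 (toBox i.hN z).1 (toBox i.hN z).2
        (by rw [hyl]; omega) (by rw [hzl']; omega)
      have hd' := torusSupNorm_lt_of_mem_torusCube i hy hz
      have hlt : i.R * S < n * S := by exact_mod_cast lt_trans hsep hd'
      have hℓ1 : 1 ≤ ℓ + 1 := Nat.succ_pos ℓ
      have : n ≤ i.R := le_trans (by simpa using Nat.mul_le_mul_left n hℓ1) hnR
      nlinarith
    have hS' : S = (ℓ + 1) * bigSide ℓ i.Mh (j - 1) := by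
      rw [hSdef]; unfold B6MultiLevelBoxOperator.bigSide
      rw [show j + 1 = (j - 1 + 1) + 1 by omega, pow_succ]; ring
    have hcube : torusCube c₀ (n * S) = torusCube c₀ ((n * (ℓ + 1)) * bigSide ℓ i.Mh (j - 1)) := by
      rw [hS']; ring_nf
    rw [hcube]
    refine alignedCube_mem_cubeClassP i (j := j - 1) (n := n * (ℓ + 1)) (by omega) (by omega)
      (le_trans (by omega : 1 ≤ 10) (le_trans hn10 (Nat.le_mul_of_pos_right n (Nat.succ_pos ℓ)))) ?_ c₀ ?_ ?_ ?_
    · calc c ≤ 10 := hc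
        _ ≤ ((n * (ℓ + 1) : ℕ) : ℝ) := by exact_mod_cast le_trans hn10 (Nat.le_mul_of_pos_right n (Nat.succ_pos ℓ))
    · intro κ
      exact dvd_trans (Dvd.intro_left _ hS'.symm) (hc₀ κ)
    · intro z hz
      rw [← hcube] at hz
      have h1 := hwin z hz
      have h2 := hnoup z hz
      omega
    · exact ⟨y, by rw [← hcube]; exact hy, by omega⟩
  · left
    push Not at hlow
    refine alignedCube_mem_cubeClassP i hj1 hjk (le_trans (by norm_num) hn10) (by exact_mod_cast le_trans hc (by exact_mod_cast hn10)) c₀ hc₀ ?_ ⟨x, hx, hxj⟩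
    intro z hz
    have h1 := hwin z hz
    have h2 := hlow z hz
    omega

/-- THE COLLAR BUDGET AT EVERY INDEX: `2L ≤ (L − 4)·M_h` (`M_h = L^a ≥ 8`, `L ≥ 5`: for `L = 5` the exponent `a ≥ 2` gives `M_h ≥ 25`; for `L ≥ 6`, `a ≥ 1`
gives `M_h ≥ L` and `L − 4 ≥ 2`). [cite: Balaban1984PropagatorsII, (2.1) p.224 (M = L^a; bookkeeping on the index)] -/
theorem two_L_le_collarBlocks_mul_Mh : 2 * (ℓ + 1) ≤ (ℓ - 3) * i.Mh := by
  obtain ⟨a, ha⟩ : ∃ a, i.Mh = (ℓ + 1) ^ a := ⟨_, i.hMha⟩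
  have h8 : 8 ≤ i.Mh := i.hM8
  have hℓ : 4 ≤ ℓ := i.hℓ
  rcases Nat.lt_or_ge a 1 with ha0 | ha1
  · exfalso
    have : a = 0 := by omega
    rw [this, pow_zero] at ha
    omega
  rcases Nat.lt_or_ge ℓ 5 with hℓ4 | hℓ5
  · -- `ℓ = 4`, `L = 5`: `a ≥ 2`
    have hℓe : ℓ = 4 := by omega
    subst hℓe
    have ha2 : 2 ≤ a := by
      by_contra h
      have : a = 1 := by omega
      rw [this] at ha; norm_num at ha; omega
    have : (4 + 1) ^ 2 ≤ (4 + 1) ^ a := Nat.pow_le_pow_right (by norm_num) ha2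
    rw [← ha] at this
    omega
  · have hM : ℓ + 1 ≤ i.Mh := by
      rw [ha]
      calc ℓ + 1 = (ℓ + 1) ^ 1 := (pow_one _).symm
        _ ≤ (ℓ + 1) ^ a := Nat.pow_le_pow_right (Nat.succ_pos ℓ) ha1
    calc 2 * (ℓ + 1) ≤ 2 * i.Mh := Nat.mul_le_mul_left 2 hM
      _ ≤ (ℓ - 3) * i.Mh := Nat.mul_le_mul_right _ (by omega)

/-- THE READING BUDGET AT EVERY INDEX: `4L ≤ (L − 4)·M_h` — the `Q`-stencil runs reach `< 2L^{j(ι)}` from a base point itself `< 2L^{j(ι)}` from `□̃`,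
`j(ι) ≤ j(□) + 2`, so `4L^{j(□)+2} ≤ (L − 4)·S_{j(□)}` is what the collar must hold (`M_h = L^a ≥ 8`: `L ≤ 7 ⇒ a ≥ 2 ⇒ M_h ≥ L² ≥ 5L`; `L ≥ 8 ⇒ M_h ≥ L`,
`L − 4 ≥ 4`). [cite: Balaban1984PropagatorsII, (2.1) p.224 (M = L^a; bookkeeping on the index); Balaban1985BackgroundPropagators, p.408 («Ω_j(□) = □̃⁴»)] -/
theorem four_L_le_collarBlocks_mul_Mh : 4 * (ℓ + 1) ≤ (ℓ - 3) * i.Mh := by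
  obtain ⟨a, ha⟩ : ∃ a, i.Mh = (ℓ + 1) ^ a := ⟨_, i.hMha⟩
  have h8 : 8 ≤ i.Mh := i.hM8
  have hℓ : 4 ≤ ℓ := i.hℓ
  rcases Nat.lt_or_ge a 1 with ha0 | ha1
  · exfalso
    have : a = 0 := by omega
    rw [this, pow_zero] at ha
    omega
  rcases Nat.lt_or_ge ℓ 7 with hℓ7 | hℓ7
  · -- `L ≤ 7`: `a ≥ 2`, `M_h ≥ L² ≥ 5L`
    have ha2 : 2 ≤ a := by
      by_contra h
      have : a = 1 := by omega
      rw [this, pow_one] at ha; omega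
    have hM : (ℓ + 1) ^ 2 ≤ i.Mh := by rw [ha]; exact Nat.pow_le_pow_right (Nat.succ_pos ℓ) ha2
    have h5 : 4 * (ℓ + 1) ≤ (ℓ - 3) * (ℓ + 1) ^ 2 := by
      interval_cases ℓ <;> norm_num
    exact le_trans h5 (Nat.mul_le_mul_left _ hM)
  · have hM : ℓ + 1 ≤ i.Mh := by
      rw [ha]
      calc ℓ + 1 = (ℓ + 1) ^ 1 := (pow_one _).symm
        _ ≤ (ℓ + 1) ^ a := Nat.pow_le_pow_right (Nat.succ_pos ℓ) ha1
    calc 4 * (ℓ + 1) ≤ 4 * i.Mh := Nat.mul_le_mul_left 4 hM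
      _ ≤ (ℓ - 3) * i.Mh := Nat.mul_le_mul_right _ (by omega)

/-- hence the collar of the wide cover holds the `Q`-stencil reach: `4L^{j+2} ≤ (L − 4)·S_j`. [cite: Balaban1985BackgroundPropagators, p.408 («Ω_j(□) = □̃⁴»; bookkeeping)] -/
theorem four_pow_le_collar (j : ℕ) : 4 * (ℓ + 1) ^ (j + 2) ≤ (ℓ - 3) * bigSide ℓ i.Mh j := by
  have h := four_L_le_collarBlocks_mul_Mh i
  unfold B6MultiLevelBoxOperator.bigSide
  calc 4 * (ℓ + 1) ^ (j + 2) = (4 * (ℓ + 1)) * (ℓ + 1) ^ (j + 1) := by ring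
    _ ≤ ((ℓ - 3) * i.Mh) * (ℓ + 1) ^ (j + 1) := Nat.mul_le_mul_right _ h
    _ = (ℓ - 3) * (i.Mh * (ℓ + 1) ^ (j + 1)) := by ring

/-- THE WIDE WINDOW ARITHMETIC (all integers): representative within `13S/4` of the centre (times `4`), site within `S/8` of the representative (times `8`),
collar within `K` with `K + 27S/8 < (ℓ + ½)S` — here `K = (ℓ − 3)S` — ⇒ the label relative to the corner `(β − ℓ)S` lies in `[0, 2(ℓ+1)S)`.
[cite: Balaban1985BackgroundPropagators, p.409 («□̃⁵ ⊂ one class cube»; bookkeeping)] -/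
theorem window_arith_wide {S N w z r b m m' : ℤ} {ℓz : ℤ} (hS : 0 < S)
    (hrep : |4 * r - (4 * b + 2) * S - 4 * (N * m)| ≤ 13 * S) (hz : 8 * |z - r| < S) (hw : |w - z - N * m'| ≤ (ℓz - 3) * S) :
    0 ≤ w - (b - ℓz) * S - N * (m + m') ∧ w - (b - ℓz) * S - N * (m + m') < 2 * (ℓz + 1) * S := by
  have h1 := abs_le.1 hrep
  have h2 := abs_lt.1 (show |z - r| < S from by have := abs_nonneg (z - r); linarith)
  have h2' : 8 * (z - r) < S ∧ -S < 8 * (z - r) := by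
    constructor <;> nlinarith [abs_nonneg (z - r), le_abs_self (z - r), neg_abs_le (z - r)]
  have h3 := abs_le.1 hw
  have hℓS : 0 ≤ (ℓz - 3) * S := le_trans (abs_nonneg _) hw
  constructor <;> nlinarith [hℓS]
end Geometry

/-! ## §2 `□̃(c)` and a collar of `L − 4` big blocks lie in one cube of print's class -/

section Cover

variable {d ℓ : ℕ} {hd : 1 ≤ d + 1} {hL : Odd (ℓ + 1) ∧ 1 < ℓ + 1} {b₀ b₁ : ℝ} {Mstar : ℕ}
variable (x : MemberY d ℓ hd hL b₀ b₁ Mstar)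

/-- THE WIDE LABEL WINDOW OF A COLLAR SITE: for `z ∈ □̃(c)` (`c = (j, β)`, `S = bigSide j`) and a torus site `w` with `circAbs ≤ (ℓ − 3)·S` from `z` in the
coordinate `μ`: `0 ≤ w_μ − (β_μ − ℓ)S − N·m < 2(ℓ+1)S` for some integer `m`. [cite: Balaban1985BackgroundPropagators, p.409, p.408 («Ω_j(□) = □̃⁴»); Balaban1984PropagatorsII, p.235, (2.2) p.224] -/
theorem exists_wideWindow_of_mem_cubeDomY_collar (c : ↥(cubes x.toKIdx.D.toDomains)) {z : SiteY x.toKIdx} (hz : z ∈ cubeDomY x c)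
    (w : Site (PV d ℓ x.m x.K hd hL) 0) (μ : Fin (PV d ℓ x.m x.K hd hL).d)
    (hw : circAbs ((PV d ℓ x.m x.K hd hL).sitesPerDir 0) (((w μ).val : ℤ) - z.1 μ) ≤ ((ℓ : ℤ) - 3) * (bigSide ℓ x.Mh c.1.1 : ℤ)) :
    ∃ m : ℤ, 0 ≤ ((w μ).val : ℤ) - (c.1.2 μ - ℓ) * (bigSide ℓ x.Mh c.1.1 : ℤ) - ((PV d ℓ x.m x.K hd hL).sitesPerDir 0 : ℤ) * m ∧
      ((w μ).val : ℤ) - (c.1.2 μ - ℓ) * (bigSide ℓ x.Mh c.1.1 : ℤ) - ((PV d ℓ x.m x.K hd hL).sitesPerDir 0 : ℤ) * m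
        < ((2 * (ℓ + 1) * bigSide ℓ x.Mh c.1.1 : ℕ) : ℤ) := by
  obtain ⟨S, hSdef⟩ : ∃ S : ℕ, S = bigSide ℓ x.Mh c.1.1 := ⟨_, rfl⟩
  have h8 : 8 ≤ x.toKIdx.Mh := x.toKIdx.hM8
  have hℓ : 4 ≤ ℓ := x.toKIdx.hℓ
  have hS : 0 < S := by rw [hSdef]; unfold B6MultiLevelBoxOperator.bigSide; positivity
  have hN1 : 1 ≤ (PV d ℓ x.m x.K hd hL).sitesPerDir 0 := Nat.one_le_iff_ne_zero.2 ((PV d ℓ x.m x.K hd hL).sitesPerDir_ne_zero 0)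
  have hzblk : blkOf x.toKIdx.D.toDomains z ∈ cubeBlksY x c := (Finset.mem_filter.1 hz).2
  have hwin := B6Cover236QbigOverlapV1.window_and_congr_of_mem_QbigT x.toKIdx.D hL (le_trans (by norm_num) h8) x.toKIdx.hR2
    (one_le_Mh_and_P x.toKIdx).1 (four_le_P x) hzblk
  obtain ⟨⟨-, hlevhi⟩, hrep⟩ := hwin
  obtain ⟨m, hm⟩ := hrep μ
  rw [x.toKIdx.hN μ, ← hSdef] at hm
  have hm4 : |(4 : ℝ) * ((((rep x.toKIdx.D.toDomains (blkOf x.toKIdx.D.toDomains z)).1 μ : ℤ) : ℝ) - ((c.1.2 μ : ℝ) + 1 / 2) * (S : ℝ) -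
      ((PV d ℓ x.m x.K hd hL).sitesPerDir 0 : ℝ) * (m : ℝ))| ≤ 13 * (S : ℝ) := by
    rw [abs_mul, abs_of_pos (by norm_num : (0 : ℝ) < 4)]; linarith
  have hmZ : |4 * (rep x.toKIdx.D.toDomains (blkOf x.toKIdx.D.toDomains z)).1 μ - (4 * c.1.2 μ + 2) * (S : ℤ) -
      4 * (((PV d ℓ x.m x.K hd hL).sitesPerDir 0 : ℤ) * m)| ≤ 13 * (S : ℤ) := by
    have h' : |(4 : ℝ) * (((rep x.toKIdx.D.toDomains (blkOf x.toKIdx.D.toDomains z)).1 μ : ℤ) : ℝ) - (4 * (c.1.2 μ : ℝ) + 2) * (S : ℝ) -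
        4 * (((PV d ℓ x.m x.K hd hL).sitesPerDir 0 : ℝ) * (m : ℝ))| ≤ 13 * (S : ℝ) := by
      have e : (4 : ℝ) * (((rep x.toKIdx.D.toDomains (blkOf x.toKIdx.D.toDomains z)).1 μ : ℤ) : ℝ) - (4 * (c.1.2 μ : ℝ) + 2) * (S : ℝ) -
          4 * (((PV d ℓ x.m x.K hd hL).sitesPerDir 0 : ℝ) * (m : ℝ)) =
          (4 : ℝ) * ((((rep x.toKIdx.D.toDomains (blkOf x.toKIdx.D.toDomains z)).1 μ : ℤ) : ℝ) - ((c.1.2 μ : ℝ) + 1 / 2) * (S : ℝ) -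
            ((PV d ℓ x.m x.K hd hL).sitesPerDir 0 : ℝ) * (m : ℝ)) := by ring
      rw [e]; exact hm4
    have h'' : ((|4 * (rep x.toKIdx.D.toDomains (blkOf x.toKIdx.D.toDomains z)).1 μ - (4 * c.1.2 μ + 2) * (S : ℤ) -
        4 * (((PV d ℓ x.m x.K hd hL).sitesPerDir 0 : ℤ) * m)| : ℤ) : ℝ) ≤ ((13 * (S : ℤ) : ℤ) : ℝ) := by
      push_cast; exact h'
    exact_mod_cast h''
  have hzrep := abs_sub_rep_lt_of_blkOf_eq x.toKIdx (a := blkOf x.toKIdx.D.toDomains z) rfl μ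
  have hside : 8 * (((ℓ + 1) ^ (blkOf x.toKIdx.D.toDomains z).1.1 : ℕ) : ℤ) ≤ (S : ℤ) := by
    have h1 : (ℓ + 1) ^ (blkOf x.toKIdx.D.toDomains z).1.1 ≤ (ℓ + 1) ^ (c.1.1 + 1) := Nat.pow_le_pow_right (Nat.succ_pos ℓ) hlevhi
    have h2 : 8 * (ℓ + 1) ^ (c.1.1 + 1) ≤ S := by
      rw [hSdef]; unfold B6MultiLevelBoxOperator.bigSide; exact Nat.mul_le_mul_right _ h8
    exact_mod_cast le_trans (Nat.mul_le_mul_left 8 h1) h2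
  have hzZ : 8 * |z.1 μ - (rep x.toKIdx.D.toDomains (blkOf x.toKIdx.D.toDomains z)).1 μ| < (S : ℤ) := by
    have := abs_nonneg (z.1 μ - (rep x.toKIdx.D.toDomains (blkOf x.toKIdx.D.toDomains z)).1 μ)
    linarith
  have hw' : circAbs ((PV d ℓ x.m x.K hd hL).sitesPerDir 0) (((w μ).val : ℤ) - z.1 μ) ≤ ((ℓ : ℤ) - 3) * (S : ℤ) := by rw [hSdef]; exact hw
  obtain ⟨m', hm'⟩ := exists_abs_sub_le_of_circAbs_le hN1 hw'
  have hSZ : (0 : ℤ) < (S : ℤ) := by exact_mod_cast hS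
  have key := window_arith_wide hSZ hmZ hzZ hm'
  refine ⟨m + m', ?_, ?_⟩
  · rw [← hSdef]; exact key.1
  · rw [← hSdef]; push_cast; exact key.2

/-- ★★★ **`□̃(c)` AND A COLLAR OF `L − 4` BIG BLOCKS LIE IN ONE CUBE OF PRINT'S CLASS**: for a cover cube `c = (j, β)` and a threshold `cthr ≤ 10`, the
aligned cube `Q` of `2L` big `j`-blocks cornered at `(β − (L−1))·S_j` is a P-triple of index `j` (size `2L`) or `j − 1` (size `2L²`), and contains every
torus site within coordinatewise `circAbs ≤ (L − 4)·S_j` of a site of `□̃(c) = cubeDomY x c` — the margin that holds the `Q(U)`-averaging runs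
(`2L^{j+2} ≤ 2S_j·L∕M_h ≤ (L−4)·S_j`). [cite: Balaban1985BackgroundPropagators, p.409 («□̃⁵ … one of the cubes»), p.408 («Ω_j(□) = □̃⁴»); Balaban1984PropagatorsII, (2.2) p.224, p.235] -/
theorem exists_cubeClassP_cubeDomY_wideCollar (c : ↥(cubes x.toKIdx.D.toDomains)) {cthr : ℝ} (hc : cthr ≤ 10) :
    ∃ q ∈ cubeClassP x.toKIdx cthr,
      ((q.2.1 = c.1.1 ∧ q.2.2 = 2 * (ℓ + 1)) ∨ (q.2.1 + 1 = c.1.1 ∧ q.2.2 = 2 * (ℓ + 1) * (ℓ + 1))) ∧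
      ∀ z ∈ cubeDomY x c, ∀ w : Site (PV d ℓ x.m x.K hd hL) 0,
        (∀ μ, circAbs ((PV d ℓ x.m x.K hd hL).sitesPerDir 0) (((w μ).val : ℤ) - z.1 μ) ≤ ((ℓ : ℤ) - 3) * (bigSide ℓ x.Mh c.1.1 : ℤ)) → w ∈ q.1 := by
  classical
  obtain ⟨S, hSdef⟩ : ∃ S : ℕ, S = bigSide ℓ x.Mh c.1.1 := ⟨_, rfl⟩
  have h8 : 8 ≤ x.toKIdx.Mh := x.toKIdx.hM8
  have hℓ : 4 ≤ ℓ := x.toKIdx.hℓ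
  have hS : 0 < S := by rw [hSdef]; unfold B6MultiLevelBoxOperator.bigSide; positivity
  -- the witness: a site of level `j` in `[βS, (β+1)S)`
  obtain ⟨x₀, hx₀def⟩ : ∃ x₀ : Site (PV d ℓ x.m x.K hd hL) 0, x₀ = (boxEquiv x.toKIdx.hN).symm (wit x.toKIdx.D.toDomains c) := ⟨_, rfl⟩
  have hx₀box : toBox x.toKIdx.hN x₀ = wit x.toKIdx.D.toDomains c := by
    have := (boxEquiv x.toKIdx.hN).apply_symm_apply (wit x.toKIdx.D.toDomains c)
    rw [hx₀def]; simpa only [boxEquiv_apply] using this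
  have hx₀lev : levV1 x.toKIdx x₀ = c.1.1 := by
    show x.toKIdx.D.lev (toBox x.toKIdx.hN x₀).1 = c.1.1
    rw [hx₀box]
    exact lev_wit x.toKIdx.D.toDomains c
  have hjk : c.1.1 ≤ x.toKIdx.k := hx₀lev ▸ levV1_le x.toKIdx x₀
  have hj1 : 1 ≤ c.1.1 := hx₀lev ▸ levV1_pos x.toKIdx x₀
  have hsN : S ∣ (PV d ℓ x.m x.K hd hL).sitesPerDir 0 := by
    have hNe : (PV d ℓ x.m x.K hd hL).sitesPerDir 0 = bigSide ℓ x.Mh x.k * x.P' 0 := by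
      rw [← x.toKIdx.hN 0, B6MultiLevelTorusOperator.N0_eq_bigSide_mul]
    rw [hNe, hSdef]
    exact dvd_mul_of_dvd_left ⟨(ℓ + 1) ^ (x.k - c.1.1), bigSide_eq_mul_pow hjk⟩ _
  -- the corner `(β − ℓ)·S`
  obtain ⟨c₀, hc₀def⟩ : ∃ c₀ : Site (PV d ℓ x.m x.K hd hL) 0,
      c₀ = fun μ => (((c.1.2 μ - ℓ) * (S : ℤ) : ℤ) : ZMod ((PV d ℓ x.m x.K hd hL).sitesPerDir 0)) := ⟨_, rfl⟩
  have hc₀ : ∀ μ, S ∣ (c₀ μ).val := by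
    intro μ
    have hval : ((c₀ μ).val : ℤ) = ((c.1.2 μ - ℓ) * (S : ℤ)) % ((PV d ℓ x.m x.K hd hL).sitesPerDir 0 : ℤ) := by
      rw [hc₀def]; exact ZMod.val_intCast _
    have hdvd : (S : ℤ) ∣ ((c₀ μ).val : ℤ) := by
      rw [hval, Int.emod_def]
      exact dvd_sub (dvd_mul_left _ _) (dvd_mul_of_dvd_left (Int.natCast_dvd_natCast.2 hsN) _)
    exact_mod_cast hdvd
  have hx₀Q : x₀ ∈ torusCube c₀ (2 * (ℓ + 1) * S) := by
    intro μ
    have hcoord : (wit x.toKIdx.D.toDomains c).1 μ / (S : ℤ) = c.1.2 μ := by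
      have := congrFun (blk_wit x.toKIdx.D.toDomains c) μ
      rw [← hSdef] at this
      exact this
    have hS0 : (0 : ℤ) < (S : ℤ) := by exact_mod_cast hS
    have hlo : (S : ℤ) * c.1.2 μ ≤ (wit x.toKIdx.D.toDomains c).1 μ := by rw [← hcoord]; exact Int.mul_ediv_self_le (ne_of_gt hS0)
    have hhi : (wit x.toKIdx.D.toDomains c).1 μ < (S : ℤ) * c.1.2 μ + S := by rw [← hcoord]; exact Int.lt_mul_ediv_self_add hS0
    have hval : ((x₀ μ).val : ℤ) = (wit x.toKIdx.D.toDomains c).1 μ := by rw [hx₀def]; exact val_boxEquiv_symm x.toKIdx.hN _ μ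
    have e : c₀ μ = (((c.1.2 μ - ℓ) * (S : ℤ) : ℤ) : ZMod ((PV d ℓ x.m x.K hd hL).sitesPerDir 0)) := by rw [hc₀def]
    have hℓZ : (4 : ℤ) ≤ (ℓ : ℤ) := by exact_mod_cast hℓ
    rw [e]
    refine val_sub_intCast_lt_of_window x.toKIdx x₀ μ _ 0 ?_ ?_
    · rw [hval, mul_zero, sub_zero]; nlinarith
    · rw [hval, mul_zero, sub_zero]; push_cast; nlinarith
  have hnR : 2 * (ℓ + 1) * (ℓ + 1) ≤ x.toKIdx.R := by have := x.toKIdx.hR2; nlinarith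
  rw [hSdef] at hc₀ hx₀Q
  have hP := alignedCube_mem_cubeClassP_or x.toKIdx hc (by omega : 10 ≤ 2 * (ℓ + 1)) hnR hj1 hjk c₀ hc₀ hx₀Q hx₀lev
  -- the collar lies in `Q`
  have hcollar : ∀ z ∈ cubeDomY x c, ∀ w : Site (PV d ℓ x.m x.K hd hL) 0,
      (∀ μ, circAbs ((PV d ℓ x.m x.K hd hL).sitesPerDir 0) (((w μ).val : ℤ) - z.1 μ) ≤ ((ℓ : ℤ) - 3) * (bigSide ℓ x.Mh c.1.1 : ℤ)) →
        w ∈ torusCube c₀ (2 * (ℓ + 1) * S) := by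
    intro z hz w hw μ
    obtain ⟨m, h0, h10⟩ := exists_wideWindow_of_mem_cubeDomY_collar x c hz w μ (hw μ)
    rw [← hSdef] at h0 h10
    have e : c₀ μ = (((c.1.2 μ - ℓ) * (S : ℤ) : ℤ) : ZMod ((PV d ℓ x.m x.K hd hL).sitesPerDir 0)) := by rw [hc₀def]
    rw [e]
    exact val_sub_intCast_lt_of_window x.toKIdx w μ _ m h0 h10
  rw [hSdef] at hcollar
  rcases hP with hP | hP
  · exact ⟨_, hP, Or.inl ⟨rfl, rfl⟩, hcollar⟩
  · exact ⟨_, hP, Or.inr ⟨by simp only; omega, rfl⟩, hcollar⟩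
end Cover

/-! ## §3 The (3.35) datum — one gauge, one small field — on the wide collar of `□̃(c)` -/

section Datum

variable {d ℓ : ℕ} {hd : 1 ≤ d + 1} {hL : Odd (ℓ + 1) ∧ 1 < ℓ + 1} {b₀ b₁ : ℝ} {Mstar : ℕ}
variable {𝔸 : Type} [NormedRing 𝔸] [NormedAlgebra ℂ 𝔸] [CompleteSpace 𝔸] {G : Subgroup 𝔸ˣ}
variable (x : MemberY d ℓ hd hL b₀ b₁ Mstar)

/-- the (3.35) datum read off a P-triple that is EITHER `(Q, j, 2L)` OR `(Q, j−1, 2L²)`, on any sub-set of `Q`, at the scale `Lʲη` with the constant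
`2L⁴·(M·α₀)`. [cite: Balaban1985BackgroundPropagators, (3.35) p.396] -/
theorem reg335Cube_of_wideCover_or (i : KIdx d ℓ hd hL b₀ b₁) {cthr α₀ : ℝ} (hα : 0 ≤ α₀) {U : CfgV1 (PV d ℓ i.m i.K hd hL) 𝔸}
    (h : (bg9KP 𝔸 G i).Reg335 cthr α₀ U) {q : Set (Site (PV d ℓ i.m i.K hd hL) 0) × ℕ × ℕ} (hq : q ∈ cubeClassP i cthr) {j : ℕ}
    (hcase : (q.2.1 = j ∧ q.2.2 = 2 * (ℓ + 1)) ∨ (q.2.1 + 1 = j ∧ q.2.2 = 2 * (ℓ + 1) * (ℓ + 1))) {W : Set (Site (PV d ℓ i.m i.K hd hL) 0)} (hW : W ⊆ q.1) :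
    Reg335Cube (shiftsV1 (PV d ℓ i.m i.K hd hL)) U (kGeo i).eta W (scaleLen (kGeo i).L (kGeo i).eta j) (2 * (kGeo i).L ^ 4 * ((kGeo i).M * α₀)) := by
  obtain ⟨hη, hL1, hM⟩ := eta_pos_L_one_le_M_pos i
  have hMα : 0 ≤ (kGeo i).M * α₀ := mul_nonneg hM.le hα
  have hL0 : 0 < (kGeo i).L := lt_of_lt_of_le one_pos hL1
  have hLdef : (kGeo i).L = ((ℓ + 1 : ℕ) : ℝ) := rfl
  have hdat := reg335CubeP_of_reg335P_subset (𝔸 := 𝔸) (G := G) i h hq hW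
  rcases hcase with ⟨hj, hn⟩ | ⟨hj, hn⟩
  · rw [hj, hn] at hdat
    refine reg335Cube_mono_const (le_of_lt (LatticeNorms.scaleLen_pos hL0 hη _)) ?_ hdat
    have h1 : (1 : ℝ) ≤ (kGeo i).L ^ 3 := one_le_pow₀ hL1
    have e : ((2 * (ℓ + 1) : ℕ) : ℝ) = 2 * (kGeo i).L := by rw [hLdef]; push_cast; ring
    rw [e]
    have : 2 * (kGeo i).L * ((kGeo i).M * α₀) ≤ 2 * (kGeo i).L * (kGeo i).L ^ 3 * ((kGeo i).M * α₀) := by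
      nlinarith [mul_nonneg (mul_nonneg (by norm_num : (0:ℝ) ≤ 2) hL0.le) (mul_nonneg (sub_nonneg.2 h1) hMα)]
    calc 2 * (kGeo i).L * ((kGeo i).M * α₀) ≤ 2 * (kGeo i).L * (kGeo i).L ^ 3 * ((kGeo i).M * α₀) := this
      _ = 2 * (kGeo i).L ^ 4 * ((kGeo i).M * α₀) := by ring
  · rw [hn] at hdat
    rw [← hj, scaleLen_succ']
    have hsc := reg335Cube_scale_up (shiftsV1 (PV d ℓ i.m i.K hd hL)) U (t := (kGeo i).L) hL1 (LatticeNorms.scaleLen_pos hL0 hη q.2.1)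
      (mul_nonneg (by positivity) hMα) hdat
    refine reg335Cube_mono_const (mul_nonneg hL0.le (le_of_lt (LatticeNorms.scaleLen_pos hL0 hη q.2.1))) (le_of_eq ?_) hsc
    rw [hLdef]; push_cast; ring

/-- ★★ **(3.35) ON THE WIDE COLLAR OF `□̃(c)`, FROM PRINT'S CLASS**: ONE gauge `u` and ONE field `A` with `U^u = e^{iηA}`, `|A| < C·(Lʲη)⁻¹`,
`|∇^ηA| < C·(Lʲη)⁻²`, `C = 2L⁴·(M·α₀)`, on all torus sites within coordinatewise `circAbs ≤ (L − 4)·S_j` of `□̃(c)` (`j = j(c)`), from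
`(bg9KP 𝔸 G x.toKIdx).Reg335 cthr α₀ U` (`cthr ≤ 10`, `α₀ ≥ 0`). [cite: Balaban1985BackgroundPropagators, (3.35) p.396, p.409, p.408, p.416 («the gauge in which U = e^{iηA}»)] -/
theorem reg335Cube_cubeDomY_wideCollar_of_reg335P (c : ↥(cubes x.toKIdx.D.toDomains)) {cthr α₀ : ℝ} (hc : cthr ≤ 10) (hα : 0 ≤ α₀)
    {U : CfgV1 (PV d ℓ x.m x.K hd hL) 𝔸} (h : (bg9KP 𝔸 G x.toKIdx).Reg335 cthr α₀ U) :
    Reg335Cube (shiftsV1 (PV d ℓ x.m x.K hd hL)) U (kGeo x.toKIdx).eta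
      {w | ∃ z ∈ cubeDomY x c, ∀ μ, circAbs ((PV d ℓ x.m x.K hd hL).sitesPerDir 0) (((w μ).val : ℤ) - z.1 μ) ≤ ((ℓ : ℤ) - 3) * (bigSide ℓ x.Mh c.1.1 : ℤ)}
      (scaleLen (kGeo x.toKIdx).L (kGeo x.toKIdx).eta c.1.1) (2 * (kGeo x.toKIdx).L ^ 4 * ((kGeo x.toKIdx).M * α₀)) := by
  obtain ⟨q, hqP, hcase, hcollar⟩ := exists_cubeClassP_cubeDomY_wideCollar x c hc
  refine reg335Cube_of_wideCover_or x.toKIdx hα h hqP hcase ?_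
  rintro w ⟨z, hz, hw⟩
  exact hcollar z hz w hw

/-- ★★ MEMBER FORM (def-Y's `bg9YP`, first sequence). [cite: Balaban1985BackgroundPropagators, (3.35) p.396, p.409, p.416] -/
theorem reg335Cube_cubeDomY_wideCollar_of_regYP335 (c : ↥(cubes x.toKIdx.D.toDomains)) {cthr α₀ : ℝ} (hc : cthr ≤ 10) (hα : 0 ≤ α₀)
    {U : CfgV1 (PV d ℓ x.m x.K hd hL) 𝔸} (h : (bg9YP 𝔸 G x).Reg335 cthr α₀ U) :
    Reg335Cube (shiftsV1 (PV d ℓ x.m x.K hd hL)) U (kGeo x.toKIdx).eta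
      {w | ∃ z ∈ cubeDomY x c, ∀ μ, circAbs ((PV d ℓ x.m x.K hd hL).sitesPerDir 0) (((w μ).val : ℤ) - z.1 μ) ≤ ((ℓ : ℤ) - 3) * (bigSide ℓ x.Mh c.1.1 : ℤ)}
      (scaleLen (kGeo x.toKIdx).L (kGeo x.toKIdx).eta c.1.1) (2 * (kGeo x.toKIdx).L ^ 4 * ((kGeo x.toKIdx).M * α₀)) :=
  reg335Cube_cubeDomY_wideCollar_of_reg335P x c hc hα h.1

/-- ★ the member form at the N06 certificate's literal threshold letter `c35Y`. [cite: Balaban1985BackgroundPropagators, (3.35) p.396 («≧ 10»), p.409] -/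
theorem reg335Cube_cubeDomY_wideCollar_of_regYP335_c35Y (c : ↥(cubes x.toKIdx.D.toDomains)) {α₀ : ℝ} (hα : 0 ≤ α₀)
    {U : CfgV1 (PV d ℓ x.m x.K hd hL) 𝔸} (h : (bg9YP 𝔸 G x).Reg335 B9PinGeometryKLevelV1.c35Y α₀ U) :
    Reg335Cube (shiftsV1 (PV d ℓ x.m x.K hd hL)) U (kGeo x.toKIdx).eta
      {w | ∃ z ∈ cubeDomY x c, ∀ μ, circAbs ((PV d ℓ x.m x.K hd hL).sitesPerDir 0) (((w μ).val : ℤ) - z.1 μ) ≤ ((ℓ : ℤ) - 3) * (bigSide ℓ x.Mh c.1.1 : ℤ)}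
      (scaleLen (kGeo x.toKIdx).L (kGeo x.toKIdx).eta c.1.1) (2 * (kGeo x.toKIdx).L ^ 4 * ((kGeo x.toKIdx).M * α₀)) :=
  reg335Cube_cubeDomY_wideCollar_of_regYP335 x c (by norm_num [B9PinGeometryKLevelV1.c35Y]) hα h

end Datum

end Literature.MathematicalPhysics.QuantumFieldTheory.Balaban1983to89.B9Eq335CubeDomCoverWideP
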